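/-
COR-CM (cell pub-hodgecm2, stage 2 of the Hodge ladder) — count-neutral KERNEL COMBINATORICS «dicyclic twist, even order: the strict-half functionals
under the group» (seat prover-pub-hodgecm2-b23-g43-0, binder prover b23, gen 43; claim DICYCLIC-EVEN, HOME/INBOX.md l.10881; blanket
`Census/DicyclicTwist*`).  Theorems only, on top of `Census/DicyclicTwistEvenFunctionals.lean`; no `decide` beyond closed identities in `ZMod 2`, no
certificate, no named fact, no `sorry`.  `Interfaces.lean` (C1), every E term, B01, `Transposition/*`, `PortJoin/*` untouched.
HONEST FRAMING: `HC_CM` is NOT proved, here or anywhere in the tree; nothing here is a period, a count of record or a headline.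
T5: n/a-class (no hypothesis binders beyond the model's data); checker: self, 2026-08-23.
-/
import Summits.HodgeConjecture.CorCM.Census.DicyclicTwistEvenFunctionals

/-!
# The dicyclic twist `Dic(ℤ/2 × A)`, `|A|` even, II: the functionals `UE`, `UX`, `SE₀`, `SE₁` under the group

TRANSPORT of the four functionals of `Census/DicyclicTwistEvenFunctionals.lean` under the motions of the model (`translH g`, `translX` of
`Census/DicyclicTwistModel.lean`): a dot product against a translate is the dot product of the translated weight (`dot_translH`, `dot_translX`);
`UE s ∘ translH (0,t) = UE (s + t)`, `UX s ∘ translH (0,t) = UX (s − t)`, `SE_i ∘ translH (0,t) = SE_i`; conjugation `translH (1,0)` negates all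
four (`translH_one_zero_neg`); **`UX s ∘ translX = UE s`, `UE s ∘ translX = −UX s`, `SE₀ ∘ translX = SE₁`, `SE₁ ∘ translX = −SE₀`** (`translX_rel`).
Hence the joint vanishing of the four functionals (and of the `2|A|` functionals `UE`, `UX` alone) is stable under every translate and passes to
spans (`killedE_translH`, `killedE_translX`, `killedF_translH`, `killedF_translX`, `killedE_of_mem_span`, `killedF_of_mem_span`), and the pairs are
killed (`killedE_of_mem_pairs₂`).  All [folklore].

## References
* [Pohlmann1968] H. Pohlmann, Algebraic cycles on abelian varieties of complex multiplication type, Ann. of Math. 88 (1968), Thm 1.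
-/

namespace Summit.HodgeConjecture.CorCM.Census.DicyclicTwist

open Finset
open Summit.HodgeConjecture.CorCM.Census.OddSliceFacesModel
open Summit.HodgeConjecture.CorCM.Census.OddSliceFacesSquares
open Summit.HodgeConjecture.CorCM.Census.OddSliceFacesDescent
open Summit.HodgeConjecture.CorCM.Census.EvenSliceFacesDescent

variable (A : Type) [AddCommGroup A] [Fintype A] [DecidableEq A]

/-! ## §4 Transport under the group -/

/-- A dot product against a translate by `h`: move the translation onto the weight. [folklore] -/
theorem dot_translH (w : Ty₂ A → ℤ) (g : ZMod 2 × A) (v : Ty₂ A → ℤ) :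
    w ⬝ᵥ translH A g v = (fun Ψ => w (twH A g Ψ)) ⬝ᵥ v := by
  unfold dotProduct translH
  refine Fintype.sum_equiv (twHEquiv A (-g)) _ _ fun Ψ => ?_
  show w Ψ * v (twH A (-g) Ψ) = w (twH A g (twH A (-g) Ψ)) * v (twH A (-g) Ψ)
  rw [twH_twH, neg_add_cancel, twH_zero]

/-- A dot product against a translate by `x`: move the translation onto the weight. [folklore] -/
theorem dot_translX (w : Ty₂ A → ℤ) (v : Ty₂ A → ℤ) :
    w ⬝ᵥ translX A v = (fun Ψ => w (twX A Ψ)) ⬝ᵥ v := by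
  unfold dotProduct translX
  refine Fintype.sum_equiv (twXEquiv A).symm _ _ fun Ψ => ?_
  show w Ψ * v (twXinv A Ψ) = w (twX A (twXinv A Ψ)) * v (twXinv A Ψ)
  rw [twX_twXinv]

omit [DecidableEq A] in
/-- `wE s` at a `(0,t)`-translate is `wE (s + t)`. [folklore] -/
theorem wE_twH_zero (s t : A) (Ψ : Ty₂ A) : wE A s (twH A (0, t) Ψ) = wE A (s + t) Ψ := by
  unfold wE twH; simp only [loI_tw_zero, upI_tw_zero, dft_tw_zero]

omit [DecidableEq A] in
/-- `wX s` at a `(0,t)`-translate is `wX (s − t)`. [folklore] -/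
theorem wX_twH_zero (s t : A) (Ψ : Ty₂ A) : wX A s (twH A (0, t) Ψ) = wX A (s - t) Ψ := by
  have e : -(s - t) = -s + t := by abel
  unfold wX twH; simp only [loI_tw_zero, upI_tw_zero, dft_tw_zero, e]

omit [AddCommGroup A] [DecidableEq A] in
/-- `wS₁` at a `(0,t)`-translate. [folklore] -/
theorem wS₁_twH_zero [AddCommGroup A] (t : A) (Ψ : Ty₂ A) : wS₁ A (twH A (0, t) Ψ) = wS₁ A Ψ := by
  unfold wS₁ sgI eqI twH; simp only [loI_tw_zero, upI_tw_zero]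

omit [AddCommGroup A] [DecidableEq A] in
/-- `wS₀` at a `(0,t)`-translate. [folklore] -/
theorem wS₀_twH_zero [AddCommGroup A] (t : A) (Ψ : Ty₂ A) : wS₀ A (twH A (0, t) Ψ) = wS₀ A Ψ := by
  unfold wS₀ sgI eqI twH; simp only [loI_tw_zero, upI_tw_zero]

omit [DecidableEq A] in
/-- The weights at a `(1,0)`-translate (conjugation) change sign. [folklore] -/
theorem weights_twH_one_zero (s : A) (Ψ : Ty₂ A) :
    wE A s (twH A (1, 0) Ψ) = -wE A s Ψ ∧ wX A s (twH A (1, 0) Ψ) = -wX A s Ψ ∧ wS₁ A (twH A (1, 0) Ψ) = -wS₁ A Ψ ∧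
      wS₀ A (twH A (1, 0) Ψ) = -wS₀ A Ψ := by
  obtain ⟨a, b⟩ := Ψ
  rw [twH_one_zero]
  exact ⟨wE_conj A s a b, wX_conj A s a b, wS₁_conj A a b, wS₀_conj A a b⟩

omit [DecidableEq A] in
/-- **The weights at an `x`-translate**: `wE s ∘ twX = −wX s`, `wX s ∘ twX = wE s`, `wS₁ ∘ twX = −wS₀`, `wS₀ ∘ twX = wS₁`. [folklore] -/
theorem weights_twX (s : A) (Ψ : Ty₂ A) :
    wE A s (twX A Ψ) = -wX A s Ψ ∧ wX A s (twX A Ψ) = wE A s Ψ ∧ wS₁ A (twX A Ψ) = -wS₀ A Ψ ∧ wS₀ A (twX A Ψ) = wS₁ A Ψ := by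
  obtain ⟨a, b⟩ := Ψ
  unfold wE wX wS₁ wS₀ sgI eqI twX
  simp only [loI_add_one, upI_add_one, dft_add_one, loI_rev, upI_rev, dft_rev, neg_neg]
  refine ⟨by ring, by ring, by ring, by ring⟩

/-- **`UE s ∘ translH (0,t) = UE (s + t)`.** [folklore] -/
theorem UE_translH_zero (s t : A) (v : Ty₂ A → ℤ) : UE A s (translH A (0, t) v) = UE A (s + t) v := by
  rw [UE_apply, UE_apply, dot_translH]; congr 1; funext Ψ; exact wE_twH_zero A s t Ψ

/-- **`UX s ∘ translH (0,t) = UX (s − t)`.** [folklore] -/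
theorem UX_translH_zero (s t : A) (v : Ty₂ A → ℤ) : UX A s (translH A (0, t) v) = UX A (s - t) v := by
  rw [UX_apply, UX_apply, dot_translH]; congr 1; funext Ψ; exact wX_twH_zero A s t Ψ

/-- `SE₁ ∘ translH (0,t) = SE₁`. [folklore] -/
theorem SE₁_translH_zero (t : A) (v : Ty₂ A → ℤ) : SE₁ A (translH A (0, t) v) = SE₁ A v := by
  rw [SE₁_apply, SE₁_apply, dot_translH]; congr 1; funext Ψ; exact wS₁_twH_zero A t Ψ

/-- `SE₀ ∘ translH (0,t) = SE₀`. [folklore] -/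
theorem SE₀_translH_zero (t : A) (v : Ty₂ A → ℤ) : SE₀ A (translH A (0, t) v) = SE₀ A v := by
  rw [SE₀_apply, SE₀_apply, dot_translH]; congr 1; funext Ψ; exact wS₀_twH_zero A t Ψ

/-- **Conjugation negates all four functionals.** [folklore] -/
theorem translH_one_zero_neg (v : Ty₂ A → ℤ) :
    (∀ s, UE A s (translH A (1, 0) v) = -UE A s v) ∧ (∀ s, UX A s (translH A (1, 0) v) = -UX A s v) ∧
      SE₀ A (translH A (1, 0) v) = -SE₀ A v ∧ SE₁ A (translH A (1, 0) v) = -SE₁ A v := by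
  refine ⟨fun s => ?_, fun s => ?_, ?_, ?_⟩
  · rw [UE_apply, UE_apply, dot_translH, ← neg_dotProduct]; congr 1; funext Ψ
    rw [Pi.neg_apply]; exact (weights_twH_one_zero A s Ψ).1
  · rw [UX_apply, UX_apply, dot_translH, ← neg_dotProduct]; congr 1; funext Ψ
    rw [Pi.neg_apply]; exact (weights_twH_one_zero A s Ψ).2.1
  · rw [SE₀_apply, SE₀_apply, dot_translH, ← neg_dotProduct]; congr 1; funext Ψ
    rw [Pi.neg_apply]; exact (weights_twH_one_zero A (0 : A) Ψ).2.2.2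
  · rw [SE₁_apply, SE₁_apply, dot_translH, ← neg_dotProduct]; congr 1; funext Ψ
    rw [Pi.neg_apply]; exact (weights_twH_one_zero A (0 : A) Ψ).2.2.1

/-- **`x`-translates: `UE s (x·v) = −UX s v`, `UX s (x·v) = UE s v`, `SE₁ (x·v) = −SE₀ v`, `SE₀ (x·v) = SE₁ v`.** [folklore] -/
theorem translX_rel (v : Ty₂ A → ℤ) :
    (∀ s, UE A s (translX A v) = -UX A s v) ∧ (∀ s, UX A s (translX A v) = UE A s v) ∧
      SE₁ A (translX A v) = -SE₀ A v ∧ SE₀ A (translX A v) = SE₁ A v := by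
  refine ⟨fun s => ?_, fun s => ?_, ?_, ?_⟩
  · rw [UE_apply, UX_apply, dot_translX, ← neg_dotProduct]; congr 1; funext Ψ
    rw [Pi.neg_apply]; exact (weights_twX A s Ψ).1
  · rw [UX_apply, UE_apply, dot_translX]; congr 1; funext Ψ; exact (weights_twX A s Ψ).2.1
  · rw [SE₁_apply, SE₀_apply, dot_translX, ← neg_dotProduct]; congr 1; funext Ψ
    rw [Pi.neg_apply]; exact (weights_twX A (0 : A) Ψ).2.2.1
  · rw [SE₀_apply, SE₁_apply, dot_translX]; congr 1; funext Ψ; exact (weights_twX A (0 : A) Ψ).2.2.2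

/-- **Joint vanishing is stable under every `h`-translate**: if all four functionals vanish on `v` they vanish on `translH g v`. [folklore] -/
theorem killedE_translH {v : Ty₂ A → ℤ} (hv : (∀ s, UE A s v = 0) ∧ (∀ s, UX A s v = 0) ∧ SE₀ A v = 0 ∧ SE₁ A v = 0) (g : ZMod 2 × A) :
    (∀ s, UE A s (translH A g v) = 0) ∧ (∀ s, UX A s (translH A g v) = 0) ∧ SE₀ A (translH A g v) = 0 ∧ SE₁ A (translH A g v) = 0 := by
  obtain ⟨e, t⟩ := g
  have h01 : ∀ u : ZMod 2, u = 0 ∨ u = 1 := by decide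
  have h0 : (∀ s, UE A s (translH A (0, t) v) = 0) ∧ (∀ s, UX A s (translH A (0, t) v) = 0) ∧ SE₀ A (translH A (0, t) v) = 0 ∧
      SE₁ A (translH A (0, t) v) = 0 :=
    ⟨fun s => by rw [UE_translH_zero, hv.1], fun s => by rw [UX_translH_zero, hv.2.1], by rw [SE₀_translH_zero, hv.2.2.1],
      by rw [SE₁_translH_zero, hv.2.2.2]⟩
  rcases h01 e with rfl | rfl
  · exact h0
  · have e : ((1 : ZMod 2), t) = ((1 : ZMod 2), (0 : A)) + ((0 : ZMod 2), t) := by rw [Prod.mk_add_mk, add_zero, zero_add]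
    have hn := translH_one_zero_neg A (translH A (0, t) v)
    rw [e, ← translH_translH]
    exact ⟨fun s => by rw [hn.1 s, h0.1 s, neg_zero], fun s => by rw [hn.2.1 s, h0.2.1 s, neg_zero],
      by rw [hn.2.2.1, h0.2.2.1, neg_zero], by rw [hn.2.2.2, h0.2.2.2, neg_zero]⟩

/-- Joint vanishing is stable under the `x`-translate. [folklore] -/
theorem killedE_translX {v : Ty₂ A → ℤ} (hv : (∀ s, UE A s v = 0) ∧ (∀ s, UX A s v = 0) ∧ SE₀ A v = 0 ∧ SE₁ A v = 0) :
    (∀ s, UE A s (translX A v) = 0) ∧ (∀ s, UX A s (translX A v) = 0) ∧ SE₀ A (translX A v) = 0 ∧ SE₁ A (translX A v) = 0 := by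
  have h := translX_rel A v
  exact ⟨fun s => by rw [h.1 s, hv.2.1 s, neg_zero], fun s => by rw [h.2.1 s, hv.1 s], by rw [h.2.2.2, hv.2.2.2],
    by rw [h.2.2.1, hv.2.2.1, neg_zero]⟩

/-- **`F`-vanishing (`UE`, `UX` only) is stable under every `h`-translate.** [folklore] -/
theorem killedF_translH {v : Ty₂ A → ℤ} (hv : (∀ s, UE A s v = 0) ∧ (∀ s, UX A s v = 0)) (g : ZMod 2 × A) :
    (∀ s, UE A s (translH A g v) = 0) ∧ (∀ s, UX A s (translH A g v) = 0) := by
  obtain ⟨e, t⟩ := g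
  have h01 : ∀ u : ZMod 2, u = 0 ∨ u = 1 := by decide
  have h0 : (∀ s, UE A s (translH A (0, t) v) = 0) ∧ (∀ s, UX A s (translH A (0, t) v) = 0) :=
    ⟨fun s => by rw [UE_translH_zero, hv.1], fun s => by rw [UX_translH_zero, hv.2]⟩
  rcases h01 e with rfl | rfl
  · exact h0
  · have e : ((1 : ZMod 2), t) = ((1 : ZMod 2), (0 : A)) + ((0 : ZMod 2), t) := by rw [Prod.mk_add_mk, add_zero, zero_add]
    have hn := translH_one_zero_neg A (translH A (0, t) v)
    rw [e, ← translH_translH]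
    exact ⟨fun s => by rw [hn.1 s, h0.1 s, neg_zero], fun s => by rw [hn.2.1 s, h0.2 s, neg_zero]⟩

/-- `F`-vanishing is stable under the `x`-translate. [folklore] -/
theorem killedF_translX {v : Ty₂ A → ℤ} (hv : (∀ s, UE A s v = 0) ∧ (∀ s, UX A s v = 0)) :
    (∀ s, UE A s (translX A v) = 0) ∧ (∀ s, UX A s (translX A v) = 0) := by
  have h := translX_rel A v
  exact ⟨fun s => by rw [h.1 s, hv.2 s, neg_zero], fun s => by rw [h.2.1 s, hv.1 s]⟩

/-- Joint vanishing passes to spans. [folklore] -/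
theorem killedE_of_mem_span {T : Set (Ty₂ A → ℤ)} (hT : ∀ v ∈ T, (∀ s, UE A s v = 0) ∧ (∀ s, UX A s v = 0) ∧ SE₀ A v = 0 ∧ SE₁ A v = 0)
    {v : Ty₂ A → ℤ} (hv : v ∈ Submodule.span ℤ T) : (∀ s, UE A s v = 0) ∧ (∀ s, UX A s v = 0) ∧ SE₀ A v = 0 ∧ SE₁ A v = 0 := by
  refine Submodule.span_induction (p := fun w _ => (∀ s, UE A s w = 0) ∧ (∀ s, UX A s w = 0) ∧ SE₀ A w = 0 ∧ SE₁ A w = 0) hT ?_ ?_ ?_ hv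
  · exact ⟨fun s => map_zero _, fun s => map_zero _, map_zero _, map_zero _⟩
  · intro x y _ _ hx hy
    exact ⟨fun s => by rw [map_add, hx.1 s, hy.1 s, add_zero], fun s => by rw [map_add, hx.2.1 s, hy.2.1 s, add_zero],
      by rw [map_add, hx.2.2.1, hy.2.2.1, add_zero], by rw [map_add, hx.2.2.2, hy.2.2.2, add_zero]⟩
  · intro c x _ hx
    exact ⟨fun s => by rw [map_smul, hx.1 s, smul_zero], fun s => by rw [map_smul, hx.2.1 s, smul_zero],
      by rw [map_smul, hx.2.2.1, smul_zero], by rw [map_smul, hx.2.2.2, smul_zero]⟩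

/-- `F`-vanishing passes to spans. [folklore] -/
theorem killedF_of_mem_span {T : Set (Ty₂ A → ℤ)} (hT : ∀ v ∈ T, (∀ s, UE A s v = 0) ∧ (∀ s, UX A s v = 0))
    {v : Ty₂ A → ℤ} (hv : v ∈ Submodule.span ℤ T) : (∀ s, UE A s v = 0) ∧ (∀ s, UX A s v = 0) := by
  refine Submodule.span_induction (p := fun w _ => (∀ s, UE A s w = 0) ∧ (∀ s, UX A s w = 0)) hT ?_ ?_ ?_ hv
  · exact ⟨fun s => map_zero _, fun s => map_zero _⟩
  · intro x y _ _ hx hy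
    exact ⟨fun s => by rw [map_add, hx.1 s, hy.1 s, add_zero], fun s => by rw [map_add, hx.2 s, hy.2 s, add_zero]⟩
  · intro c x _ hx
    exact ⟨fun s => by rw [map_smul, hx.1 s, smul_zero], fun s => by rw [map_smul, hx.2 s, smul_zero]⟩

/-- **The pairs are killed** (all of `P₂`). [folklore] -/
theorem killedE_of_mem_pairs₂ {v : Ty₂ A → ℤ} (hv : v ∈ pairs₂ A) :
    (∀ s, UE A s v = 0) ∧ (∀ s, UX A s v = 0) ∧ SE₀ A v = 0 ∧ SE₁ A v = 0 := by
  refine killedE_of_mem_span A ?_ hv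
  rintro _ ⟨Ψ, rfl⟩
  exact killed_pairVec₂ A Ψ

/-- Differences of vectors with the same functionals are killed (bookkeeping). [folklore] -/
theorem killedE_sub {y z : Ty₂ A → ℤ} (hy : (∀ s, UE A s y = 0) ∧ (∀ s, UX A s y = 0) ∧ SE₀ A y = 0 ∧ SE₁ A y = 0)
    (hz : (∀ s, UE A s z = 0) ∧ (∀ s, UX A s z = 0) ∧ SE₀ A z = 0 ∧ SE₁ A z = 0) :
    (∀ s, UE A s (y - z) = 0) ∧ (∀ s, UX A s (y - z) = 0) ∧ SE₀ A (y - z) = 0 ∧ SE₁ A (y - z) = 0 :=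
  ⟨fun s => by rw [map_sub, hy.1 s, hz.1 s, sub_zero], fun s => by rw [map_sub, hy.2.1 s, hz.2.1 s, sub_zero],
    by rw [map_sub, hy.2.2.1, hz.2.2.1, sub_zero], by rw [map_sub, hy.2.2.2, hz.2.2.2, sub_zero]⟩

end Summit.HodgeConjecture.CorCM.Census.DicyclicTwist
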